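import Mathlib.MeasureTheory.Measure.Haar.DistribChar
import Mathlib.MeasureTheory.Measure.Haar.MulEquivHaarChar
import Mathlib.MeasureTheory.Constructions.Pi
import Mathlib.LinearAlgebra.Matrix.Transvection
import Mathlib.LinearAlgebra.Matrix.ToLinearEquiv
import Mathlib.LinearAlgebra.Determinant
import Mathlib.Topology.Algebra.Module.Equiv
import HarnessLib

/-!
# The linear Jacobian over a locally compact field: `μ (L S) = mod_F(det L) · μ S`

Topic `Literature/MeasureTheory/Group` (siblings ★ `PadicIntHaarScaling`, ★ `PadicIntHaarLinearMaps` — the `ℤ_p`-INTEGRAL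
twin `μ(A·S) = |det A|_p μ(S)` for `A ∈ Mₙ(ℤ_p)` via Smith normal form — and ★ `LocalFieldGLnVolume`); namespace
`Literature.MeasureTheory.Group`.  THEOREMS ONLY (no definition ∕ instance ∕ notation ∕ named fact ∕ `sorry`); imports
Mathlib + `HarnessLib`.  Cell `pub/hodgecm-mathlib`, crux H413 = `stmt-HodgeConjecture-24833` (lane `--supports`, count-neutral):
brick **C6 «LINEAR JACOBIAN OVER A LOCAL FIELD»** of the ROAD «JAC-ELL» (LH5-p02 (g6), the local tube Jacobian at a compact
Cartan of `U(Φ₃)(L⁺_v)` via the ★ Cayley window; consumer C8 `F0P3cStCharTSJacCartanElliptic`), seat LH10-p01 (g6),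
2026-09-02.  HONEST LABEL: HC_CM is proved only modulo the 7 printed citations (2 remaining: hLiu418 = `stmt-HodgeConjecture-24832`,
h413 = `stmt-HodgeConjecture-24833`) until rung 0 closes; this file closes no organ.

## The statement

Let `F` be a locally compact, second countable topological field (`ℝ`, `ℂ`, a finite extension of `ℚ_p`, `𝔽_q((t))`, …),
`d = #ι`, and `μ` an additive Haar measure on `Fᵈ = ι → F`.  Weil's **module** of `a ∈ Fˣ` is the constant `mod_F(a)` with
`μ₁(a S) = mod_F(a) μ₁(S)` for a Haar measure `μ₁` of `F`; in Mathlib it is `distribHaarChar F a : ℝ≥0` (hypothesis-free;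
`= |a|` for `ℝ`, `|a|²` for `ℂ`, the normalised absolute value `‖a‖_F = q^{−v(a)}` for `F` non-archimedean —
★ `Literature.NumberTheory.Automorphic.UnitaryGroup.distribHaarChar_eq_normAbs`, ★ `distribHaarChar_padic_eq_nnnorm`).  Then
for every linear automorphism `L` of `Fᵈ` and EVERY set `S`

  **`μ (L S) = mod_F(det L) · μ S`**   (`addHaar_image_linearEquiv`, `addHaar_image_mulVec` for `L = (x ↦ M x)`, `M ∈ GL_d(F)`),

equivalently the Haar character of `L` (Mathlib `addEquivAddHaarChar`, the scaling factor of a bi-continuous additive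
automorphism) is `mod_F(det L)` (`addEquivAddHaarChar_continuousLinearEquiv`); with the preimage ∕ push-forward ∕ integral forms
(`addHaar_preimage_linearEquiv`, `map_linearEquiv_addHaar`, `lintegral_comp_linearEquiv`), the diagonal, homothety and
transvection special cases (`addHaar_image_diagonal_mulVec`, `addHaar_smul_of_units`, `addHaar_image_transvection_mulVec`), and
the transport to ANY `F`-space `V` with a continuous linear trivialisation `e : V ≃L[F] (ι → F)` — the consumer's Lie-algebra
chart is an `F`-subspace of `M₃(K)`, not literally `Fᵈ` — (`addEquivAddHaarChar_continuousLinearEquiv_of_trivialization`,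
`addHaar_image_continuousLinearEquiv_of_trivialization`, `…preimage…`, `map_…`; `exists_continuousLinearEquiv_of_basis` builds `e`
from a basis with continuous coordinates).  The real case is Mathlib's `MeasureTheory.Measure.addHaar_image_linearMap`.

## The proof (no Smith form, no Iwasawa decomposition, no Fubini)

`GL_d(F)` is generated by invertible diagonal matrices and transvections — Mathlib's induction principle
`Matrix.diagonal_transvection_induction_of_det_ne_zero` — and both sides are multiplicative (`addEquivAddHaarChar_trans`,
`LinearEquiv.det_trans`), so two cases remain:
* DIAGONAL `x ↦ (dᵢ xᵢ)ᵢ`: evaluate the product Haar measure `⊗ᵢ μ₁` on the box `∏ᵢ dᵢ K` (`K` a compact neighbourhood of `0`):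
  `χ = ∏ᵢ mod_F(dᵢ) = mod_F(∏ dᵢ)` (`addEquivAddHaarChar_eq_prod_of_apply_eq_mul`; Mathlib `Measure.pi_pi`, `distribHaarChar_mul`);
* TRANSVECTION `t = t_{ij}(c) = 1 + c E_{ij}` (`i ≠ j`): the «`χ² = 1`» trick — `t(−c) ∘ t(c) = id` and `t(−c) = D t(c) D` for the
  involution `D = diag(1, …, −1ᵢ, …, 1)`, so `χ(t)² = χ(t) χ(t(−c)) = χ(id) = 1` and `χ(t) = 1 = mod_F(det t)`, in every
  characteristic (`addEquivAddHaarChar_eq_one_of_apply_eq_transvection_mulVec`; §1 `addEquivAddHaarChar_eq_one_of_conj_inverse`,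
  the pattern of `Summit.Ventures.HodgeRepro.Tier4.Line1.HaarCharInvolution`, re-derived here because Literature does not import Summits).
§1 also supplies the generic dictionary `μ (φ S) = χ(φ) μ S`, `μ (φ⁻¹ S) = χ(φ)⁻¹ μ S`, `φ_* μ = χ(φ)⁻¹ μ` and the transport of `χ`
along a bi-continuous isomorphism between two groups (`addEquivAddHaarChar_eq_of_semiconj`).  On `ι → F` every Haar measure is
automatically regular (second countability), so the `Fᵈ` statements carry no `Regular` hypothesis; the abstract-`V` ones do.
Not treated: the singular case `det = 0` (needs `F` non-discrete).

## References
* [WeilBNT1967] A. Weil, *Basic Number Theory* (1967), Ch. I §2 («mod_V(L) = mod_K(det L)» for an automorphism `L` of a finite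
  dimensional vector space over a locally compact field, Cor. 3 of Prop. 2 ∕ Thm. 3).
  -- TODO(general form): Weil allows left vector spaces over locally compact division rings (reduced norm).
* N. Bourbaki, *Intégration*, Ch. VII §1 no. 10 (module of an automorphism). [folklore]
-/

set_option autoImplicit false

noncomputable section

open MeasureTheory MeasureTheory.Measure Set
open scoped ENNReal NNReal Pointwise Matrix

namespace Literature.MeasureTheory.Group

/-! ## §1 Haar characters of continuous additive automorphisms (generic locally compact abelian group) -/

section Generic

variable {V : Type*} [AddCommGroup V] [TopologicalSpace V] [IsTopologicalAddGroup V]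
  [MeasurableSpace V] [BorelSpace V] [LocallyCompactSpace V]

/-- **`μ (φ '' s) = χ(φ) · μ s`**: a continuous additive automorphism `φ` multiplies every regular Haar measure of
images by its Haar character `addEquivAddHaarChar φ` (Mathlib: `χ(φ) • μ (φ ⁻¹' X) = μ X`). [cite: WeilBNT1967, Ch. I §2] -/
theorem measure_image_eq_addEquivAddHaarChar_mul (μ : Measure V) [μ.IsAddHaarMeasure] [μ.Regular]
    (φ : V ≃ₜ+ V) (s : Set V) : μ (φ '' s) = addEquivAddHaarChar φ * μ s := by
  have h := addEquivAddHaarChar_smul_preimage μ (X := φ '' s) φ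
  rw [φ.injective.preimage_image] at h
  rw [← h, ENNReal.smul_def, smul_eq_mul]

/-- **`μ (φ ⁻¹' s) = χ(φ)⁻¹ · μ s`** for a continuous additive automorphism `φ` and a regular Haar measure `μ`.
[cite: WeilBNT1967, Ch. I §2] -/
theorem measure_preimage_eq_addEquivAddHaarChar_inv_mul (μ : Measure V) [μ.IsAddHaarMeasure]
    [μ.Regular] (φ : V ≃ₜ+ V) (s : Set V) :
    μ (φ ⁻¹' s) = (addEquivAddHaarChar φ)⁻¹ * μ s := by
  have hpre : φ ⁻¹' s = φ.symm '' s := (φ.toEquiv.image_symm_eq_preimage s).symm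
  rw [hpre, measure_image_eq_addEquivAddHaarChar_mul μ φ.symm s, addEquivAddHaarChar_symm,
    ENNReal.coe_inv (addEquivAddHaarChar_pos φ).ne']

/-- **`μ.map φ = χ(φ)⁻¹ • μ`** for a continuous additive automorphism `φ` and a regular Haar measure `μ`. [cite: WeilBNT1967, Ch. I §2] -/
theorem map_eq_addEquivAddHaarChar_inv_smul (μ : Measure V) [μ.IsAddHaarMeasure] [μ.Regular]
    (φ : V ≃ₜ+ V) : μ.map φ = (addEquivAddHaarChar φ)⁻¹ • μ := by
  ext s hs
  rw [Measure.map_apply (map_continuous φ).measurable hs, Measure.smul_apply,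
    measure_preimage_eq_addEquivAddHaarChar_inv_mul μ φ s, ENNReal.smul_def, smul_eq_mul,
    ENNReal.coe_inv (addEquivAddHaarChar_pos φ).ne']

/-- **An involution has Haar character `1`** (`χ(J)² = χ(J ∘ J) = χ(id) = 1`, `χ(J) > 0`). [cite: WeilBNT1967, Ch. I §2] -/
theorem addEquivAddHaarChar_eq_one_of_involutive (J : V ≃ₜ+ V) (hJ : ∀ x, J (J x) = x) :
    addEquivAddHaarChar J = 1 := by
  have h1 : J.trans J = ContinuousAddEquiv.refl V := ContinuousAddEquiv.ext fun x => hJ x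
  have h2 : addEquivAddHaarChar J * addEquivAddHaarChar J = 1 := by
    rw [← addEquivAddHaarChar_trans, h1, addEquivAddHaarChar_refl]
  have h3 : addEquivAddHaarChar J ^ 2 = 1 := by rw [sq, h2]
  exact (pow_eq_one_iff_of_nonneg (addEquivAddHaarChar_pos J).le two_ne_zero).1 h3

/-- **Conjugation by an involution does not change the Haar character**: if `ψ = J ∘ φ ∘ J` with `J ∘ J = id` then
`χ(ψ) = χ(J) χ(φ) χ(J) = χ(φ)`. [cite: WeilBNT1967, Ch. I §2] -/
theorem addEquivAddHaarChar_eq_of_conj_involutive (φ ψ J : V ≃ₜ+ V) (hJ : ∀ x, J (J x) = x)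
    (hconj : ∀ x, ψ x = J (φ (J x))) : addEquivAddHaarChar ψ = addEquivAddHaarChar φ := by
  have h1 : ψ = (J.trans φ).trans J := ContinuousAddEquiv.ext fun x => by
    rw [ContinuousAddEquiv.coe_trans, Function.comp_apply, ContinuousAddEquiv.coe_trans,
      Function.comp_apply]
    exact hconj x
  rw [h1, addEquivAddHaarChar_trans, addEquivAddHaarChar_trans,
    addEquivAddHaarChar_eq_one_of_involutive J hJ, one_mul, mul_one]

/-- **The «`χ² = 1`» trick**: if `ψ ∘ φ = id` and `ψ` is conjugate to `φ` by an involution, then `χ(φ)² = χ(φ) χ(ψ) = χ(id) = 1`,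
so `χ(φ) = 1` — the mechanism by which a transvection (shear) is seen to preserve Haar measure without Fubini. [cite: WeilBNT1967, Ch. I §2] -/
theorem addEquivAddHaarChar_eq_one_of_conj_inverse (φ ψ J : V ≃ₜ+ V) (hJ : ∀ x, J (J x) = x)
    (hconj : ∀ x, ψ x = J (φ (J x))) (hinv : ∀ x, ψ (φ x) = x) : addEquivAddHaarChar φ = 1 := by
  have h1 : φ.trans ψ = ContinuousAddEquiv.refl V := ContinuousAddEquiv.ext fun x => hinv x
  have h2 : addEquivAddHaarChar φ * addEquivAddHaarChar ψ = 1 := by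
    rw [← addEquivAddHaarChar_trans, h1, addEquivAddHaarChar_refl]
  rw [addEquivAddHaarChar_eq_of_conj_involutive φ ψ J hJ hconj] at h2
  have h3 : addEquivAddHaarChar φ ^ 2 = 1 := by rw [sq, h2]
  exact (pow_eq_one_iff_of_nonneg (addEquivAddHaarChar_pos φ).le two_ne_zero).1 h3

variable {W : Type*} [AddCommGroup W] [TopologicalSpace W] [IsTopologicalAddGroup W]
  [MeasurableSpace W] [BorelSpace W] [LocallyCompactSpace W]

omit [IsTopologicalAddGroup V] [LocallyCompactSpace V] [IsTopologicalAddGroup W] [LocallyCompactSpace W] in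
/-- Push-forward along a bi-continuous additive isomorphism, evaluated on ANY set (measurable equivalences need no
measurability hypothesis). [folklore] -/
private theorem map_continuousAddEquiv_apply (μ : Measure V) (e : V ≃ₜ+ W) (s : Set W) :
    μ.map e s = μ (e ⁻¹' s) := by
  have h := MeasurableEquiv.map_apply (μ := μ) e.toHomeomorph.toMeasurableEquiv s
  simp only [Homeomorph.toMeasurableEquiv_coe] at h
  exact h

/-- **Transport of the Haar character**: if `e : V ≃ W` is a bi-continuous additive isomorphism intertwining
`φ ∈ Aut(V)` with `ψ ∈ Aut(W)` (`e ∘ φ = ψ ∘ e`), then `χ(φ) = χ(ψ)` — whatever Borel structures `V` and `W` carry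
(compare the images of one compact neighbourhood under a Haar measure of `V` and its push-forward to `W`). [cite: WeilBNT1967, Ch. I §2] -/
theorem addEquivAddHaarChar_eq_of_semiconj (e : V ≃ₜ+ W) (φ : V ≃ₜ+ V) (ψ : W ≃ₜ+ W)
    (h : ∀ x, e (φ x) = ψ (e x)) : addEquivAddHaarChar φ = addEquivAddHaarChar ψ := by
  obtain ⟨K⟩ := (inferInstance : Nonempty (TopologicalSpace.PositiveCompacts V))
  have hK0 : addHaarMeasure K (K : Set V) ≠ 0 := by rw [addHaarMeasure_self]; exact one_ne_zero
  have hKt : addHaarMeasure K (K : Set V) ≠ ∞ := K.isCompact.measure_lt_top.ne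
  haveI : ((addHaarMeasure K).map e).Regular := Regular.map e.toHomeomorph
  have hVW : addHaarMeasure K (φ '' (K : Set V)) = ((addHaarMeasure K).map e) (ψ '' (e '' (K : Set V))) := by
    rw [map_continuousAddEquiv_apply]
    congr 1
    ext x
    simp only [Set.mem_preimage, Set.mem_image]
    constructor
    · rintro ⟨y, hy, rfl⟩
      exact ⟨e y, ⟨y, hy, rfl⟩, (h y).symm⟩
    · rintro ⟨_, ⟨y, hy, rfl⟩, hyx⟩
      refine ⟨y, hy, e.injective ?_⟩
      rw [h y, hyx]
  have hWK : ((addHaarMeasure K).map e) (e '' (K : Set V)) = addHaarMeasure K (K : Set V) := by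
    rw [map_continuousAddEquiv_apply, e.injective.preimage_image]
  rw [measure_image_eq_addEquivAddHaarChar_mul (addHaarMeasure K) φ,
    measure_image_eq_addEquivAddHaarChar_mul ((addHaarMeasure K).map e) ψ, hWK] at hVW
  exact_mod_cast (ENNReal.mul_left_inj hK0 hKt).1 hVW

end Generic

/-! ## §2 Linear automorphisms of `Fᵈ` over a locally compact field `F`: diagonal maps, transvections, and the
determinant formula for the Haar character -/

section Field

variable {F : Type*} [Field F] [TopologicalSpace F] [IsTopologicalRing F] [LocallyCompactSpace F]
  [SecondCountableTopology F] [MeasurableSpace F] [BorelSpace F]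
  {ι : Type*} [Fintype ι] [DecidableEq ι]

omit [LocallyCompactSpace F] [SecondCountableTopology F] [MeasurableSpace F] [BorelSpace F] [DecidableEq ι] in
/-- Every linear automorphism of `ι → F` (`ι` finite, `F` a topological field) is bi-continuous: it is the underlying
linear equivalence of a continuous linear equivalence. [folklore] -/
private theorem exists_continuousLinearEquiv_eq (L : (ι → F) ≃ₗ[F] (ι → F)) :
    ∃ Lc : (ι → F) ≃L[F] (ι → F), Lc.toLinearEquiv = L :=
  ⟨ContinuousLinearEquiv.mk L L.toLinearMap.continuous_on_pi L.symm.toLinearMap.continuous_on_pi, rfl⟩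

omit [LocallyCompactSpace F] [SecondCountableTopology F] [MeasurableSpace F] [BorelSpace F] in
/-- An invertible matrix `M` acts on `ι → F` by a continuous linear automorphism `x ↦ M x`. [folklore] -/
private theorem exists_continuousLinearEquiv_mulVec (M : Matrix ι ι F) (hM : M.det ≠ 0) :
    ∃ L : (ι → F) ≃L[F] (ι → F), ∀ x, L x = M *ᵥ x := by
  obtain ⟨L, hL⟩ :=
    exists_continuousLinearEquiv_eq (Matrix.toLinearEquiv' M (Matrix.invertibleOfIsUnitDet M (Ne.isUnit hM)))
  refine ⟨L, fun x => ?_⟩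
  have h : L x = L.toLinearEquiv x := rfl
  rw [h, hL]
  simp [Matrix.toLinearEquiv']

omit [IsTopologicalRing F] [LocallyCompactSpace F] [SecondCountableTopology F] [MeasurableSpace F] [BorelSpace F] in
/-- If the continuous linear automorphism `L` of `ι → F` is `x ↦ M x`, then `det L = det M`. [folklore] -/
private theorem coe_det_eq_det_of_apply_eq_mulVec (L : (ι → F) ≃L[F] (ι → F)) (M : Matrix ι ι F)
    (hL : ∀ x, L x = M *ᵥ x) : (LinearEquiv.det L.toLinearEquiv : F) = M.det := by
  have h : (L.toLinearEquiv : (ι → F) →ₗ[F] (ι → F)) = Matrix.toLin' M := by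
    refine LinearMap.ext fun x => ?_
    rw [Matrix.toLin'_apply, ← hL x]
    rfl
  rw [LinearEquiv.coe_det, h, LinearMap.det_toLin']

omit [DecidableEq ι] in
/-- **Diagonal maps: `χ = ∏ᵢ mod_F(dᵢ)`.** If `L x = (dᵢ xᵢ)ᵢ` with units `dᵢ ∈ Fˣ`, then the Haar character of `L` on `Fᵈ` is
the product of the one-variable modules `distribHaarChar F dᵢ` (evaluate a product Haar measure on the box `∏ᵢ dᵢ K`,
`K` a compact neighbourhood of `0`; Mathlib `Measure.pi_pi`, `distribHaarChar_mul`). [cite: WeilBNT1967, Ch. I §2] -/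
theorem addEquivAddHaarChar_eq_prod_of_apply_eq_mul (L : (ι → F) ≃L[F] (ι → F)) (d : ι → Fˣ)
    (hL : ∀ x i, L x i = d i * x i) :
    addEquivAddHaarChar L.toContinuousAddEquiv = ∏ i, distribHaarChar F (d i) := by
  obtain ⟨K⟩ := (inferInstance : Nonempty (TopologicalSpace.PositiveCompacts F))
  have hK0 : addHaarMeasure K (K : Set F) ≠ 0 := by rw [addHaarMeasure_self]; exact one_ne_zero
  have hKt : addHaarMeasure K (K : Set F) ≠ ∞ := K.isCompact.measure_lt_top.ne
  have himg : (L.toContinuousAddEquiv : (ι → F) → (ι → F)) '' (Set.univ.pi fun _ : ι => (K : Set F)) =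
      Set.univ.pi fun i => d i • (K : Set F) := by
    ext y
    simp only [Set.mem_image, Set.mem_univ_pi]
    constructor
    · rintro ⟨x, hx, rfl⟩ i
      refine Set.mem_smul_set.2 ⟨x i, hx i, ?_⟩
      rw [Units.smul_def, smul_eq_mul]
      exact (hL x i).symm
    · intro hy
      choose k hk hky using fun i => Set.mem_smul_set.1 (hy i)
      refine ⟨k, hk, funext fun i => ?_⟩
      have h1 : (L.toContinuousAddEquiv : (ι → F) → (ι → F)) k i = L k i := rfl
      rw [h1, hL k i, ← hky i, Units.smul_def, smul_eq_mul]
  have h1 := measure_image_eq_addEquivAddHaarChar_mul (Measure.pi fun _ : ι => (addHaarMeasure K : Measure F))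
    L.toContinuousAddEquiv (Set.univ.pi fun _ : ι => (K : Set F))
  rw [himg, Measure.pi_pi, Measure.pi_pi] at h1
  simp only [← distribHaarChar_mul (addHaarMeasure K), Finset.prod_mul_distrib, Finset.prod_const,
    Finset.card_univ] at h1
  have hpow0 : addHaarMeasure K (K : Set F) ^ Fintype.card ι ≠ 0 := pow_ne_zero _ hK0
  have hpowt : addHaarMeasure K (K : Set F) ^ Fintype.card ι ≠ ∞ := ENNReal.pow_ne_top hKt
  have h2 := ((ENNReal.mul_left_inj hpow0 hpowt).1 h1).symm
  rw [← ENNReal.ofNNReal_finsetProd] at h2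
  exact_mod_cast h2

omit [TopologicalSpace F] [IsTopologicalRing F] [LocallyCompactSpace F] [SecondCountableTopology F] [MeasurableSpace F]
  [BorelSpace F] in
/-- The action of a transvection on vectors: `(t_{ij}(c) x)_k = x_k + δ_{ki} c x_j`. [folklore] -/
private theorem transvection_mulVec_apply {i j : ι} (c : F) (x : ι → F) (k : ι) :
    (Matrix.transvection i j c *ᵥ x) k = x k + if k = i then c * x j else 0 := by
  rw [show Matrix.transvection i j c = 1 + Matrix.single i j c from rfl, Matrix.add_mulVec, Matrix.one_mulVec, Matrix.single_mulVec, Pi.add_apply,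
    Function.update_apply, Pi.zero_apply]

/-- **Transvections preserve Haar measure: `χ(t_{ij}(c)) = 1`** (`i ≠ j`), in every characteristic and with no Fubini:
`t(−c) ∘ t(c) = id`, and `t(−c) = D ∘ t(c) ∘ D` for the involution `D = diag(1, …, −1ᵢ, …, 1)`, so `χ(t(c))² = 1`
(`addEquivAddHaarChar_eq_one_of_conj_inverse`). [cite: WeilBNT1967, Ch. I §2] -/
theorem addEquivAddHaarChar_eq_one_of_apply_eq_transvection_mulVec (L : (ι → F) ≃L[F] (ι → F)) {i j : ι}
    (hij : i ≠ j) (c : F) (hL : ∀ x, L x = Matrix.transvection i j c *ᵥ x) :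
    addEquivAddHaarChar L.toContinuousAddEquiv = 1 := by
  obtain ⟨L', hL'⟩ := exists_continuousLinearEquiv_mulVec (Matrix.transvection i j (-c))
    (by rw [Matrix.det_transvection_of_ne i j hij]; exact one_ne_zero)
  -- the sign-change involution at the coordinate `i`
  set D : (ι → F) ≃L[F] (ι → F) :=
    ContinuousLinearEquiv.piCongrRight fun k => ContinuousLinearEquiv.smulLeft (Function.update (1 : ι → Fˣ) i (-1) k)
    with hD
  have hDapp : ∀ x k, D x k = if k = i then -x k else x k := by
    intro x k
    rw [hD, ContinuousLinearEquiv.piCongrRight_apply, ContinuousLinearEquiv.smulLeft_apply_apply,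
      Function.update_apply]
    split_ifs with hk
    · rw [Units.smul_def, Units.val_neg, Units.val_one, neg_one_smul]
    · rw [Pi.one_apply, one_smul]
  refine addEquivAddHaarChar_eq_one_of_conj_inverse L.toContinuousAddEquiv L'.toContinuousAddEquiv
    D.toContinuousAddEquiv (fun x => ?_) (fun x => ?_) (fun x => ?_)
  · -- `D` is an involution
    change D (D x) = x
    funext k
    rw [hDapp, hDapp]
    split_ifs with hk
    · exact neg_neg _
    · rfl
  · -- `t(−c) = D t(c) D`
    change L' x = D (L (D x))
    funext k
    simp only [hL', hL, transvection_mulVec_apply, hDapp, if_neg (Ne.symm hij)]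
    split_ifs <;> ring
  · -- `t(−c) (t(c) x) = x`
    change L' (L x) = x
    rw [hL', hL, Matrix.mulVec_mulVec, Matrix.transvection_mul_transvection_same i j hij, neg_add_cancel,
      Matrix.transvection_zero, Matrix.one_mulVec]

/-- **`χ(L) = mod_F(det L)` for every continuous linear automorphism `L` of `Fᵈ`** — the module of a linear
automorphism of a finite-dimensional vector space over a locally compact field is the module of its determinant
(`GL_d(F)` is generated by diagonal matrices and transvections — Mathlib `Matrix.diagonal_transvection_induction_of_det_ne_zero`;
diagonals by `addEquivAddHaarChar_eq_prod_of_apply_eq_mul`, transvections by the «`χ² = 1`» trick, products by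
multiplicativity of both sides). For `F = ℝ` this is `|det L|`, for `ℂ` it is `|det L|²`, for a non-archimedean local
field the normalised absolute value `‖det L‖` (★ `UnitaryGroup.distribHaarChar_eq_normAbs`). [cite: WeilBNT1967, Ch. I §2]
-- TODO(general form): Weil states it for left vector spaces over locally compact division rings. -/
theorem addEquivAddHaarChar_continuousLinearEquiv (L : (ι → F) ≃L[F] (ι → F)) :
    addEquivAddHaarChar L.toContinuousAddEquiv = distribHaarChar F (LinearEquiv.det L.toLinearEquiv) := by
  -- the matrix of `L`
  set M : Matrix ι ι F := LinearMap.toMatrix' (L.toLinearEquiv : (ι → F) →ₗ[F] (ι → F)) with hM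
  have hLM : ∀ x, L x = M *ᵥ x := fun x => by
    rw [hM, ← Matrix.toLin'_apply, Matrix.toLin'_toMatrix']
    rfl
  have hMdet : M.det ≠ 0 := by
    rw [← coe_det_eq_det_of_apply_eq_mulVec L M hLM]
    exact Units.ne_zero _
  -- induction over `GL_d(F) = ⟨diagonals, transvections⟩`
  suffices hP : ∀ N : Matrix ι ι F, N.det ≠ 0 → ∀ L₁ : (ι → F) ≃L[F] (ι → F), (∀ x, L₁ x = N *ᵥ x) →
      addEquivAddHaarChar L₁.toContinuousAddEquiv = distribHaarChar F (LinearEquiv.det L₁.toLinearEquiv) from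
    hP M hMdet L hLM
  intro N hN
  refine Matrix.diagonal_transvection_induction_of_det_ne_zero
    (fun N => ∀ L₁ : (ι → F) ≃L[F] (ι → F), (∀ x, L₁ x = N *ᵥ x) →
      addEquivAddHaarChar L₁.toContinuousAddEquiv = distribHaarChar F (LinearEquiv.det L₁.toLinearEquiv))
    N hN (fun D hD L₁ hL₁ => ?_) (fun t L₁ hL₁ => ?_) (fun A B hA hB hPA hPB L₁ hL₁ => ?_)
  · -- diagonal
    have hD' : ∀ i, D i ≠ 0 := fun i h0 => hD (by
      rw [Matrix.det_diagonal]
      exact Finset.prod_eq_zero (Finset.mem_univ i) h0)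
    have happ : ∀ x i, L₁ x i = (Units.mk0 (D i) (hD' i) : F) * x i := fun x i => by
      rw [hL₁, Matrix.mulVec_diagonal, Units.val_mk0]
    rw [addEquivAddHaarChar_eq_prod_of_apply_eq_mul L₁ (fun i => Units.mk0 (D i) (hD' i)) happ, ← map_prod]
    congr 1
    ext
    rw [coe_det_eq_det_of_apply_eq_mulVec L₁ _ hL₁, Matrix.det_diagonal, Units.coe_prod]
    simp only [Units.val_mk0]
  · -- transvection
    rw [addEquivAddHaarChar_eq_one_of_apply_eq_transvection_mulVec L₁ t.hij t.c hL₁]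
    have hdet : LinearEquiv.det L₁.toLinearEquiv = 1 := by
      ext
      rw [coe_det_eq_det_of_apply_eq_mulVec L₁ _ hL₁, Matrix.TransvectionStruct.toMatrix,
        Matrix.det_transvection_of_ne _ _ t.hij, Units.val_one]
    rw [hdet, map_one]
  · -- product
    obtain ⟨LB, hLB⟩ := exists_continuousLinearEquiv_mulVec B hB
    have hLA : ∀ x, (LB.symm.trans L₁) x = A *ᵥ x := fun x => by
      rw [ContinuousLinearEquiv.trans_apply, hL₁]
      have hx : x = B *ᵥ (LB.symm x) := by rw [← hLB, ContinuousLinearEquiv.apply_symm_apply]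
      conv_rhs => rw [hx]
      rw [Matrix.mulVec_mulVec]
    have h1 : L₁.toContinuousAddEquiv = LB.toContinuousAddEquiv.trans (LB.symm.trans L₁).toContinuousAddEquiv :=
      ContinuousAddEquiv.ext fun x => by
        change L₁ x = (LB.symm.trans L₁) (LB x)
        rw [ContinuousLinearEquiv.trans_apply, ContinuousLinearEquiv.symm_apply_apply]
    have h2 : L₁.toLinearEquiv = LB.toLinearEquiv.trans (LB.symm.trans L₁).toLinearEquiv :=
      LinearEquiv.ext fun x => by
        change L₁ x = (LB.symm.trans L₁) (LB x)
        rw [ContinuousLinearEquiv.trans_apply, ContinuousLinearEquiv.symm_apply_apply]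
    rw [h1, addEquivAddHaarChar_trans, hPB LB hLB, hPA _ hLA, h2, LinearEquiv.det_trans, map_mul, mul_comm]


/-! ## §3 Measure forms on `Fᵈ`: images, preimages, push-forwards and integrals under matrices and linear maps -/

/-- **`μ (M S) = mod_F(det M) · μ S`** for an invertible matrix `M ∈ GL_d(F)` over a locally compact (second countable)
field `F`, every regular additive Haar measure `μ` on `Fᵈ` and EVERY set `S` — the `p`-adic ∕ local-field change of
variables for linear maps (for `F` non-archimedean, `distribHaarChar F = ‖·‖_F` is ★ `UnitaryGroup.distribHaarChar_eq_normAbs`;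
the `ℤ_p`-integral twin is ★ `padicInt_pi_volume_image_mulVec`, the real case Mathlib's `addHaar_image_linearMap`).
[cite: WeilBNT1967, Ch. I §2] -/
theorem addHaar_image_mulVec (μ : Measure (ι → F)) [μ.IsAddHaarMeasure] (M : Matrix ι ι F)
    (hM : M.det ≠ 0) (s : Set (ι → F)) :
    μ ((fun x => M *ᵥ x) '' s) = distribHaarChar F (Units.mk0 M.det hM) * μ s := by
  obtain ⟨L, hL⟩ := exists_continuousLinearEquiv_mulVec M hM
  have hfun : (fun x => M *ᵥ x) = (L.toContinuousAddEquiv : (ι → F) → (ι → F)) := funext fun x => (hL x).symm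
  have hdet : Units.mk0 M.det hM = LinearEquiv.det L.toLinearEquiv :=
    Units.ext (coe_det_eq_det_of_apply_eq_mulVec L M hL).symm
  rw [hfun, measure_image_eq_addEquivAddHaarChar_mul μ, addEquivAddHaarChar_continuousLinearEquiv L, hdet]

/-- **`μ (g S) = mod_F(det g) · μ S`** for `g ∈ GL_d(F)` (`Matrix.GeneralLinearGroup.det g ∈ Fˣ`). [cite: WeilBNT1967, Ch. I §2] -/
theorem addHaar_image_mulVec_generalLinearGroup (μ : Measure (ι → F)) [μ.IsAddHaarMeasure]
    (g : GL ι F) (s : Set (ι → F)) :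
    μ ((fun x => (g : Matrix ι ι F) *ᵥ x) '' s) = distribHaarChar F (Matrix.GeneralLinearGroup.det g) * μ s := by
  have hg : (g : Matrix ι ι F).det ≠ 0 := by
    rw [← Matrix.GeneralLinearGroup.val_det_apply]
    exact Units.ne_zero _
  rw [addHaar_image_mulVec μ (g : Matrix ι ι F) hg s]
  congr 3
  exact Units.ext (Matrix.GeneralLinearGroup.val_det_apply g).symm

/-- **`μ (L S) = mod_F(det L) · μ S`** for a linear automorphism `L` of `Fᵈ` (`LinearEquiv.det L ∈ Fˣ`). [cite: WeilBNT1967, Ch. I §2] -/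
theorem addHaar_image_linearEquiv (μ : Measure (ι → F)) [μ.IsAddHaarMeasure]
    (L : (ι → F) ≃ₗ[F] (ι → F)) (s : Set (ι → F)) :
    μ (L '' s) = distribHaarChar F (LinearEquiv.det L) * μ s := by
  obtain ⟨Lc, hLc⟩ := exists_continuousLinearEquiv_eq L
  have hfun : (L : (ι → F) → (ι → F)) = (Lc.toContinuousAddEquiv : (ι → F) → (ι → F)) := by
    rw [← hLc]; rfl
  rw [hfun, measure_image_eq_addEquivAddHaarChar_mul μ, addEquivAddHaarChar_continuousLinearEquiv Lc, hLc]

/-- **`μ (L S) = mod_F(det L) · μ S`** for a continuous linear automorphism `L` of `Fᵈ`. [cite: WeilBNT1967, Ch. I §2] -/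
theorem addHaar_image_continuousLinearEquiv (μ : Measure (ι → F)) [μ.IsAddHaarMeasure]
    (L : (ι → F) ≃L[F] (ι → F)) (s : Set (ι → F)) :
    μ (L '' s) = distribHaarChar F (LinearEquiv.det L.toLinearEquiv) * μ s := by
  rw [← addEquivAddHaarChar_continuousLinearEquiv L]
  exact measure_image_eq_addEquivAddHaarChar_mul μ L.toContinuousAddEquiv s

/-- **`μ (f S) = mod_F(det f) · μ S`** for a linear endomorphism `f` of `Fᵈ` with `det f ≠ 0`. [cite: WeilBNT1967, Ch. I §2] -/
theorem addHaar_image_linearMap (μ : Measure (ι → F)) [μ.IsAddHaarMeasure]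
    {f : (ι → F) →ₗ[F] (ι → F)} (hf : LinearMap.det f ≠ 0) (s : Set (ι → F)) :
    μ (f '' s) = distribHaarChar F (Units.mk0 (LinearMap.det f) hf) * μ s := by
  have hu : IsUnit (LinearMap.toMatrix (Pi.basisFun F ι) (Pi.basisFun F ι) f).det := by
    rw [LinearMap.toMatrix_eq_toMatrix', LinearMap.det_toMatrix']
    exact Ne.isUnit hf
  have hfun : (f : (ι → F) → (ι → F)) = (LinearEquiv.ofIsUnitDet hu : (ι → F) → (ι → F)) := by
    funext x
    rw [LinearEquiv.ofIsUnitDet_apply]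
  have hdet : Units.mk0 (LinearMap.det f) hf = LinearEquiv.det (LinearEquiv.ofIsUnitDet hu) :=
    Units.ext (by rw [Units.val_mk0, LinearEquiv.coe_det, LinearEquiv.coe_ofIsUnitDet])
  rw [hfun, addHaar_image_linearEquiv μ _ s, hdet]

/-- **`μ (L⁻¹ S) = mod_F(det L)⁻¹ · μ S`** for a linear automorphism `L` of `Fᵈ`. [cite: WeilBNT1967, Ch. I §2] -/
theorem addHaar_preimage_linearEquiv (μ : Measure (ι → F)) [μ.IsAddHaarMeasure]
    (L : (ι → F) ≃ₗ[F] (ι → F)) (s : Set (ι → F)) :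
    μ (L ⁻¹' s) = (distribHaarChar F (LinearEquiv.det L))⁻¹ * μ s := by
  have hpre : (L : (ι → F) → (ι → F)) ⁻¹' s = L.symm '' s := (L.toEquiv.image_symm_eq_preimage s).symm
  rw [hpre, addHaar_image_linearEquiv μ L.symm s, LinearEquiv.det_symm,
    map_inv (LinearEquiv.det : ((ι → F) ≃ₗ[F] (ι → F)) →* Fˣ) L,
    map_inv (distribHaarChar F) (LinearEquiv.det L), ENNReal.coe_inv (distribHaarChar_pos).ne']

/-- **`L_* μ = mod_F(det L)⁻¹ · μ`**: the push-forward of a regular Haar measure on `Fᵈ` under a linear automorphism.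
[cite: WeilBNT1967, Ch. I §2] -/
theorem map_linearEquiv_addHaar (μ : Measure (ι → F)) [μ.IsAddHaarMeasure]
    (L : (ι → F) ≃ₗ[F] (ι → F)) : μ.map L = (distribHaarChar F (LinearEquiv.det L))⁻¹ • μ := by
  obtain ⟨Lc, hLc⟩ := exists_continuousLinearEquiv_eq L
  have hmeas : Measurable (L : (ι → F) → (ι → F)) := by
    have : (L : (ι → F) → (ι → F)) = (Lc : (ι → F) → (ι → F)) := by rw [← hLc]; rfl
    rw [this]
    exact Lc.continuous.measurable
  ext s hs
  rw [Measure.map_apply hmeas hs, addHaar_preimage_linearEquiv μ L s, Measure.smul_apply, ENNReal.smul_def,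
    smul_eq_mul, ENNReal.coe_inv (distribHaarChar_pos).ne']

/-- **Linear change of variables in integrals over `Fᵈ`**: `∫ f(L x) dμ(x) = mod_F(det L)⁻¹ ∫ f dμ`.
[cite: WeilBNT1967, Ch. I §2] -/
theorem lintegral_comp_linearEquiv (μ : Measure (ι → F)) [μ.IsAddHaarMeasure]
    (L : (ι → F) ≃ₗ[F] (ι → F)) (f : (ι → F) → ℝ≥0∞) :
    ∫⁻ x, f (L x) ∂μ = (distribHaarChar F (LinearEquiv.det L))⁻¹ * ∫⁻ x, f x ∂μ := by
  obtain ⟨Lc, hLc⟩ := exists_continuousLinearEquiv_eq L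
  have hfun : (L : (ι → F) → (ι → F)) = (Lc.toHomeomorph.toMeasurableEquiv : (ι → F) → (ι → F)) := by
    rw [← hLc]; rfl
  have h1 : ∫⁻ x, f (L x) ∂μ = ∫⁻ y, f y ∂(μ.map L) := by
    rw [hfun, MeasureTheory.lintegral_map_equiv]
  rw [h1, map_linearEquiv_addHaar μ L, lintegral_smul_measure, ENNReal.smul_def, smul_eq_mul,
    ENNReal.coe_inv (distribHaarChar_pos).ne']

/-- **Diagonal change of variables**: `μ {(dᵢ xᵢ)ᵢ | x ∈ S} = (∏ᵢ mod_F(dᵢ)) · μ S` for non-zero `dᵢ`. [cite: WeilBNT1967, Ch. I §2] -/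
theorem addHaar_image_diagonal_mulVec (μ : Measure (ι → F)) [μ.IsAddHaarMeasure] (d : ι → F)
    (hd : ∀ i, d i ≠ 0) (s : Set (ι → F)) :
    μ ((fun x => Matrix.diagonal d *ᵥ x) '' s) = (∏ i, distribHaarChar F (Units.mk0 (d i) (hd i))) * μ s := by
  have hdet : (Matrix.diagonal d).det ≠ 0 := by
    rw [Matrix.det_diagonal]
    exact Finset.prod_ne_zero_iff.2 fun i _ => hd i
  rw [addHaar_image_mulVec μ _ hdet, ← map_prod]
  congr 3
  ext
  rw [Units.val_mk0, Matrix.det_diagonal, Units.coe_prod]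
  simp only [Units.val_mk0]

/-- **Homotheties**: `μ (a S) = mod_F(a)^d · μ S` for `a ∈ Fˣ` acting diagonally on `Fᵈ` (`d = #ι`). [cite: WeilBNT1967, Ch. I §2] -/
theorem addHaar_smul_of_units (μ : Measure (ι → F)) [μ.IsAddHaarMeasure] (a : Fˣ)
    (s : Set (ι → F)) : μ (a • s) = distribHaarChar F a ^ Fintype.card ι * μ s := by
  have hfun : a • s = (fun x => Matrix.diagonal (fun _ : ι => (a : F)) *ᵥ x) '' s := by
    rw [← Set.image_smul]
    congr 1
    funext x
    funext i
    rw [Matrix.mulVec_diagonal, Pi.smul_apply, Units.smul_def, smul_eq_mul]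
  rw [hfun, addHaar_image_diagonal_mulVec μ (fun _ => (a : F)) (fun _ => a.ne_zero) s, Finset.prod_const,
    Finset.card_univ, Units.mk0_val, ENNReal.coe_pow]

/-- **Transvections (shears) preserve every Haar measure on `Fᵈ`**: `μ (t_{ij}(c) S) = μ S`. [cite: WeilBNT1967, Ch. I §2] -/
theorem addHaar_image_transvection_mulVec (μ : Measure (ι → F)) [μ.IsAddHaarMeasure]
    (t : Matrix.TransvectionStruct ι F) (s : Set (ι → F)) :
    μ ((fun x => t.toMatrix *ᵥ x) '' s) = μ s := by
  have hdet : t.toMatrix.det ≠ 0 := by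
    rw [Matrix.TransvectionStruct.det]
    exact one_ne_zero
  rw [addHaar_image_mulVec μ _ hdet]
  have h1 : Units.mk0 t.toMatrix.det hdet = 1 := Units.ext (by rw [Units.val_mk0, Matrix.TransvectionStruct.det, Units.val_one])
  rw [h1, map_one, ENNReal.coe_one, one_mul]

end Field

/-! ## §4 Any finite-dimensional `F`-space with a continuous linear trivialisation (the consumer's Lie-algebra chart
`𝔤 ⊂ M₃(K)` is an `F`-subspace, not literally `Fᵈ`) -/

section Abstract

variable {F : Type*} [Field F] [TopologicalSpace F] [IsTopologicalRing F] [LocallyCompactSpace F]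
  [SecondCountableTopology F] [MeasurableSpace F] [BorelSpace F]
  {ι : Type*} [Fintype ι] [DecidableEq ι]
  {V : Type*} [AddCommGroup V] [Module F V] [TopologicalSpace V] [IsTopologicalAddGroup V]
  [MeasurableSpace V] [BorelSpace V] [LocallyCompactSpace V]

/-- **`χ(L) = mod_F(det L)` on any `F`-space `V` continuously isomorphic to `Fᵈ`** (`e : V ≃L[F] (ι → F)` a trivialisation,
`L : V ≃L[F] V`): transport along `e` (`addEquivAddHaarChar_eq_of_semiconj`) and `det (e L e⁻¹) = det L`. Any Borel
structure on `V`. [cite: WeilBNT1967, Ch. I §2] -/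
theorem addEquivAddHaarChar_continuousLinearEquiv_of_trivialization (e : V ≃L[F] (ι → F)) (L : V ≃L[F] V) :
    addEquivAddHaarChar L.toContinuousAddEquiv = distribHaarChar F (LinearEquiv.det L.toLinearEquiv) := by
  rw [addEquivAddHaarChar_eq_of_semiconj e.toContinuousAddEquiv L.toContinuousAddEquiv
    ((e.symm.trans L).trans e).toContinuousAddEquiv (fun x => ?_)]
  · rw [addEquivAddHaarChar_continuousLinearEquiv]
    congr 1
    exact LinearEquiv.det_conj L.toLinearEquiv e.toLinearEquiv
  · change e (L x) = ((e.symm.trans L).trans e) (e x)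
    rw [ContinuousLinearEquiv.trans_apply, ContinuousLinearEquiv.trans_apply, ContinuousLinearEquiv.symm_apply_apply]

/-- **`ν (L S) = mod_F(det L) · ν S`** for a regular Haar measure `ν` on an `F`-space `V` continuously isomorphic to `Fᵈ`
and a continuous linear automorphism `L` of `V`. [cite: WeilBNT1967, Ch. I §2] -/
theorem addHaar_image_continuousLinearEquiv_of_trivialization (ν : Measure V) [ν.IsAddHaarMeasure] [ν.Regular]
    (e : V ≃L[F] (ι → F)) (L : V ≃L[F] V) (s : Set V) :
    ν (L '' s) = distribHaarChar F (LinearEquiv.det L.toLinearEquiv) * ν s := by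
  rw [← addEquivAddHaarChar_continuousLinearEquiv_of_trivialization e L]
  exact measure_image_eq_addEquivAddHaarChar_mul ν L.toContinuousAddEquiv s

/-- **`ν (L⁻¹ S) = mod_F(det L)⁻¹ · ν S`** in the setting of `addHaar_image_continuousLinearEquiv_of_trivialization`.
[cite: WeilBNT1967, Ch. I §2] -/
theorem addHaar_preimage_continuousLinearEquiv_of_trivialization (ν : Measure V) [ν.IsAddHaarMeasure] [ν.Regular]
    (e : V ≃L[F] (ι → F)) (L : V ≃L[F] V) (s : Set V) :
    ν (L ⁻¹' s) = (distribHaarChar F (LinearEquiv.det L.toLinearEquiv))⁻¹ * ν s := by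
  rw [← addEquivAddHaarChar_continuousLinearEquiv_of_trivialization e L]
  exact measure_preimage_eq_addEquivAddHaarChar_inv_mul ν L.toContinuousAddEquiv s

/-- **`L_* ν = mod_F(det L)⁻¹ · ν`** in the setting of `addHaar_image_continuousLinearEquiv_of_trivialization`.
[cite: WeilBNT1967, Ch. I §2] -/
theorem map_continuousLinearEquiv_addHaar_of_trivialization (ν : Measure V) [ν.IsAddHaarMeasure] [ν.Regular]
    (e : V ≃L[F] (ι → F)) (L : V ≃L[F] V) :
    ν.map L = (distribHaarChar F (LinearEquiv.det L.toLinearEquiv))⁻¹ • ν := by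
  rw [← addEquivAddHaarChar_continuousLinearEquiv_of_trivialization e L]
  exact map_eq_addEquivAddHaarChar_inv_smul ν L.toContinuousAddEquiv

omit [IsTopologicalRing F] [LocallyCompactSpace F] [SecondCountableTopology F] [MeasurableSpace F] [BorelSpace F]
  [DecidableEq ι] [MeasurableSpace V] [BorelSpace V] [LocallyCompactSpace V] in
/-- **A basis with continuous coordinates is a continuous linear trivialisation** `V ≃L[F] (ι → F)` (the inverse
`c ↦ ∑ cᵢ bᵢ` is continuous as soon as scalar multiplication is). [cite: WeilBNT1967, Ch. I §2 Cor. 1 of Thm. 3] -/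
theorem exists_continuousLinearEquiv_of_basis [ContinuousSMul F V] (b : Module.Basis ι F V)
    (hb : ∀ i, Continuous (b.coord i)) :
    ∃ e : V ≃L[F] (ι → F), e.toLinearEquiv = b.equivFun := by
  refine ⟨ContinuousLinearEquiv.mk b.equivFun ?_ ?_, rfl⟩
  · change Continuous fun v => b.equivFun v
    refine continuous_pi fun i => ?_
    have h : Continuous fun a => b.coord i a := hb i
    simp only [Module.Basis.coord_apply] at h
    simpa only [Module.Basis.equivFun_apply] using h
  · change Continuous fun c => b.equivFun.symm c
    simp only [Module.Basis.equivFun_symm_apply]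
    fun_prop

end Abstract

end Literature.MeasureTheory.Group

end
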